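import Summits.CriticalPhenomena.SAWScalingLimit.Theses.SAWLeftRightFKG
import Summits.CriticalPhenomena.SAWScalingLimit.Theorems.LeftRightFKG.Negative.LatticePolylines
import Summits.CriticalPhenomena.SAWScalingLimit.Theorems.BoundaryTP2Negative_Box3

/-!
# Line `three-by-three-corner-witness` — skeleton for crux `NotFKGAtOne` (stmt-CriticalPhenomena-11233)

Route `route-CriticalPhenomena-SAWLeftRightFKG`, crux decl
`Summit.CriticalPhenomena.SAWScalingLimit.Theses.SAWLeftRightFKG.NotFKGAtOne` (the NEGATIVE GUARD of the
route: left–right positive association FAILS for the counting measure = fugacity `1`).  Idea card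
`Cruxes/NotFKGAtOne/Ideas/three-by-three-corner-witness.md` (ideator 2), sharpened by the triage panel
`TRIAGE-r1-{1,2,3}.md` (all pass; L1 = "`sq3` box: identification + kernel census"); line card
`Lines/three-by-three-corner-witness.md`.

## The line in one paragraph

The crux is the existential `∃ (δ, C, a, b, a', b'), ¬ CountFKG …` (`notFKGAtOne_iff`).  WITNESS: `δ = 1`,
`C = sq3` = the 16-step boundary walk of the lattice square `[-1,3]²` (so `Ω(C) = {wind ≠ 0}` is the open
square `(-1,3)²` and `Ω_1 = ℤ²[{0,1,2}²]`, the 3 × 3 box of the tree's `BoundaryTP2Negative_Box3`), corners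
`a = (0,0)`, `b = (2,2)` (boundary neighbours `a' = (0,-1)`, `b' = (2,3)`), and the two CORNER EVENTS
`A = {γ | 1 ≤ wcross 0 0 γ}` (= first step North) and `B = {γ | 1 ≤ wcross 1 1 γ}` (= last step from the West):
both are `≼`-UP-closed in EVERY domain by the landed monotonicity `wcross_le_of_wind_nonneg`
(`LeftRightFKG/Negative/LatticePolylines.lean`) — proved below (`le_wcross_of_lr`, ported verbatim from the
standing disprover's `Disproof.lean` §3) — and among the 12 corner-to-corner chords `|A| = |B| = 6`,
`|A ∩ B| = 2`: `6·6 = 36 > 24 = 12·2`.  The ORDER side is therefore closed in this file; what the stubs carry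
is the COUNT side: (1) the winding-number identification of `Ω(sq3)` (open square inside, lattice boundary
points and the outside excluded), (2) the discrete-domain graph of such an `Ω` is the induced box graph (mesh
edges + "connected ⇒ largest component = everything"), (3) the certified census of the box chords with the two
`wcross`-flags (`pathsFrom` completeness/soundness + `Measure.count = encard` + kernel `decide`).  Stubs (2) and
(3) are stated for an ARBITRARY `Ω` with the relevant property, so no transport between chord types is needed:
the composition is `Counts (dom 1 sq3)` from (3) ∘ (2) ∘ (1), then `not_countFKG_sq3_of_counts` + `notFKGAtOne_iff`.

Stubs (sorried, registered; statements are the named `Prop`s `WindBox`, `MeshBox`, `BoxCensus`, aliased under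
the stubs' own names in `Registered.*` so that the native audit accepts the composition's hypotheses BY NAME):
`stub_windBox : WindBox` (M), `stub_meshBox : MeshBox` (S/M), `stub_boxCensus : BoxCensus` (M, hardest: new
generic counting-by-enumeration lemma + `Measure.count` on a type without `Fintype`).  Composition
`NotFKGAtOne_of : Registered.stub_windBox → Registered.stub_meshBox → Registered.stub_boxCensus → NotFKGAtOne`
is sorry-free; the closing `example` feeds it the three stubs by name.  Sanity (kernel, sorry-free, this file):
`census_decide` — the four numbers 12 / 6 / 6 / 2 of `Counts` hold for the list-side enumeration
`pathsFrom eqSite nb₃ 8` with the `pathCross` flags (the cheapest falsifier of the line, run here).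

`Disproof.lean` (refuter-cdisprove-…-11233, cycle 1, rc 0, one sorry = `counts3x3`): verdict NO KILL, crux TRUE.
This line IS its §3 (`sq3`, `A₃`, `B₃`, `notFKGAtOne_of_counts3x3`) with the remaining `Counts3x3` cut into the
three stubs above; honoured: §2 `exists_incomparable_of_not_countFKG` (the 12-chord poset has 26 incomparable
pairs), `card_fkg_of_distribLattice` (it is non-distributive: backtracking chords), §4 S₁ (`|V| ≥ 8`: here 9),
S₃ (nothing is claimed at `x_c`; this is the guard at `x = 1`).  No `_false_without_` theorem and no landed
`Theorems/NotFKGAtOne/Negative/*` exist for this crux (2026-08-16); `ledger negatives`: nothing on the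
left–right order or finite SAW counts.
-/

noncomputable section

open scoped ENNReal
open MeasureTheory Set Literature.Probability.LatticeModels Literature.Probability.RandomPlanarGeometry
  Literature.Topology.PlaneTopology Summit.CriticalPhenomena.SAWScalingLimit.Theses.SAWLeftRightFKG
  Summit.CriticalPhenomena.SAWScalingLimit.Theorems.LeftRightFKG.Negative

namespace Summit.CriticalPhenomena.SAWScalingLimit.Cruxes.NotFKGAtOne.ThreeByThreeCornerWitness

/-! ## §0 Vocabulary — transparent names for the crux's own `let`-terms (as in `Disproof.lean` §1) -/

/-- `Ω(C, δ)`: the points of non-zero winding number of the mesh polyline of the closed lattice walk `C`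
(verbatim the `let Ω` of the crux). [folklore] -/
def dom (δ : ℝ) {c : Site 2} (C : (zdGraph 2).Walk c c) : Set ℂ :=
  {z | wind (fun t : ℝ => IccExtend zero_le_one (C.toCurve (meshPoint δ)) t - z) ≠ 0}

/-- The left–right preorder of the crux (verbatim its `let le`): the lens loop `γ₁ · γ₂⁻¹` winds
non-negatively about every point. [folklore] -/
def lr {Ω : Set ℂ} {δ : ℝ} {a b : Site 2} (γ₁ γ₂ : SAW.DomainSAW Ω δ a b) : Prop :=
  ∀ z : ℂ, 0 ≤ wind (fun t : ℝ =>
    IccExtend zero_le_one ((γ₁.walk.append γ₂.walk.reverse).toCurve (meshPoint δ)) t - z)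

/-- `CountFKG δ c a b a' b' C`: the ∀-body of the crux at one datum — left–right FKG in event form for the
COUNTING measure on the chords of `Ω(C)_δ` from `a` to `b`. [folklore] -/
def CountFKG (δ : ℝ) (c a b a' b' : Site 2) (C : (zdGraph 2).Walk c c) : Prop :=
  0 < δ → a' ∈ C.support → b' ∈ C.support → (zdGraph 2).Adj a a' → (zdGraph 2).Adj b b' →
  ∀ A B : Set (SAW.DomainSAW (dom δ C) δ a b), (∀ γ₁ γ₂, lr γ₁ γ₂ → γ₁ ∈ A → γ₂ ∈ A) →
    (∀ γ₁ γ₂, lr γ₁ γ₂ → γ₁ ∈ B → γ₂ ∈ B) →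
    Measure.count A * Measure.count B ≤
      Measure.count (univ : Set (SAW.DomainSAW (dom δ C) δ a b)) * Measure.count (A ∩ B)

/-- READ-BACK: the crux is the existential "some datum violates `CountFKG`" (`Iff.rfl` + `not_forall`).
[folklore] -/
theorem notFKGAtOne_iff :
    NotFKGAtOne ↔ ∃ (δ : ℝ) (c a b a' b' : Site 2) (C : (zdGraph 2).Walk c c), ¬ CountFKG δ c a b a' b' C := by
  have h : NotFKGAtOne ↔ ¬ ∀ (δ : ℝ) (c a b a' b' : Site 2) (C : (zdGraph 2).Walk c c),
      CountFKG δ c a b a' b' C := Iff.rfl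
  simp only [h, not_forall]

/-! ## §1 The witness datum: the boundary walk `sq3` of `[-1,3]²`, the box, the corner events -/

/-- Lattice point `(x, y)`. [folklore] -/
abbrev P (x y : ℤ) : Site 2 := ![x, y]

/-- One explicit step of a lattice walk (pins the intermediate vertex for `decide`). [folklore] -/
abbrev stepTo {u w : Site 2} (v : Site 2) (h : (zdGraph 2).Adj u v) (p : (zdGraph 2).Walk v w) :
    (zdGraph 2).Walk u w :=
  SimpleGraph.Walk.cons h p

/-- The boundary `C₃` of the square `[-1,3]²`: a closed lattice walk of length 16 based at `(-1,-1)`,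
counter-clockwise (verbatim `Disproof.sq3`).  `Ω(C₃) = (-1,3)²`, `V(Ω_1) = {0,1,2}²`, `Ω_1 = ℤ²[V]`.
[folklore] -/
def sq3 : (zdGraph 2).Walk (P (-1) (-1)) (P (-1) (-1)) :=
  stepTo (P 0 (-1)) (by decide) <| stepTo (P 1 (-1)) (by decide) <| stepTo (P 2 (-1)) (by decide) <|
  stepTo (P 3 (-1)) (by decide) <| stepTo (P 3 0) (by decide) <| stepTo (P 3 1) (by decide) <|
  stepTo (P 3 2) (by decide) <| stepTo (P 3 3) (by decide) <| stepTo (P 2 3) (by decide) <|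
  stepTo (P 1 3) (by decide) <| stepTo (P 0 3) (by decide) <| stepTo (P (-1) 3) (by decide) <|
  stepTo (P (-1) 2) (by decide) <| stepTo (P (-1) 1) (by decide) <| stepTo (P (-1) 0) (by decide) <|
  stepTo (P (-1) (-1)) (by decide) <| SimpleGraph.Walk.nil

/-- `(0,-1)` is a boundary vertex (below `a = (0,0)`). [folklore] -/
theorem mem_sq3_support_a' : P 0 (-1) ∈ sq3.support := by decide

/-- `(2,3)` is a boundary vertex (above `b = (2,2)`). [folklore] -/
theorem mem_sq3_support_b' : P 2 3 ∈ sq3.support := by decide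

/-- The open square `(-1,3)²` (the interior of the trace of `sq3`). [folklore] -/
def Rint₃ : Set ℂ := {z | (-1 < z.re ∧ z.re < 3) ∧ (-1 < z.im ∧ z.im < 3)}

/-- The 3 × 3 box of sites `{0,1,2}²` (the tree's `boxSites ![0,0] ![2,2]`, cf. `BoundaryTP2.Negative.Ω₃`,
`adj₃_iff`, `nb₃`, `T₃`). [folklore] -/
abbrev box₃ : Set (Site 2) := boxSites ![0, 0] ![2, 2]

/-- "The discrete domain graph of `Ω` (mesh `1`) is `ℤ²` induced on the 3 × 3 box" — the exact shape of the
tree's `BoundaryTP2.Negative.adj₃_iff` (which is this statement for `Ω = Ω₃ = siteDomain box₃`). [folklore] -/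
def BoxAdj (Ω : Set ℂ) : Prop :=
  ∀ x y : Site 2, (discreteDomainGraph Ω 1).Adj x y ↔ (zdGraph 2).Adj x y ∧ x ∈ box₃ ∧ y ∈ box₃

/-- The corner event at `a`: `{γ | 1 ≤ wcross 0 0 γ}` = {first step North, to `(0,1)`} on the 3 × 3 box
(`wcross 0 0 γ = 1 − [first step East]`: the column-0/1 edges above face `(0,0)` are at heights 1, 2, and the
net eastward flux of a chord `(0,0) → (2,2)` through the line `re = ½` is `1`). [folklore] -/
def cornerA (Ω : Set ℂ) : Set (SAW.DomainSAW Ω 1 (P 0 0) (P 2 2)) := {γ | 1 ≤ wcross 0 0 γ.walk}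

/-- The corner event at `b`: `{γ | 1 ≤ wcross 1 1 γ}` = {last step East, from `(1,2)`}
(`wcross 1 1 γ = [dart (1,2) → (2,2)]`, necessarily the last dart of a path ending at `b = (2,2)`). [folklore] -/
def cornerB (Ω : Set ℂ) : Set (SAW.DomainSAW Ω 1 (P 0 0) (P 2 2)) := {γ | 1 ≤ wcross 1 1 γ.walk}

/-- The four counts of the certificate over the chords `(0,0) → (2,2)` of `Ω_1`: `|A| = 6`, `|B| = 6`,
`|univ| = 12`, `|A ∩ B| = 2` (`Measure.count` on the `⊤` σ-algebra = `Set.encard`, `Measure.count_apply`).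
For `Ω = dom 1 sq3` this is LITERALLY `Disproof.Counts3x3`. [folklore] -/
def Counts (Ω : Set ℂ) : Prop :=
  Measure.count (cornerA Ω) = 6 ∧ Measure.count (cornerB Ω) = 6 ∧
    Measure.count (univ : Set (SAW.DomainSAW Ω 1 (P 0 0) (P 2 2))) = 12 ∧
    Measure.count (cornerA Ω ∩ cornerB Ω) = 2

/-! ## §2 The ORDER side — proved (ported from `Disproof.lean` §3, sorry-free there and here) -/

/-- **Crossing-count superlevel events are `≼`-up-closed — in EVERY domain (`δ = 1`), unconditionally.**
From the landed `wcross_le_of_wind_nonneg`: the left–right relation forces `wcross m k γ₁ ≤ wcross m k γ₂` at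
every face `(m,k)` (the height bound `Y` it asks for is supplied by the finite supports). [folklore] -/
theorem le_wcross_of_lr {Ω : Set ℂ} {a b : Site 2} (m k c : ℤ) (γ₁ γ₂ : SAW.DomainSAW Ω 1 a b)
    (h : lr γ₁ γ₂) (h₁ : c ≤ wcross m k γ₁.walk) : c ≤ wcross m k γ₂.walk := by
  have hG : ∀ x y, (discreteDomainGraph Ω 1).Adj x y → (zdGraph 2).Adj x y := fun x y hxy =>
    meshGraph_le_zdGraph Ω 1 (discreteDomainGraph_le_meshGraph Ω 1 hxy)
  classical
  obtain ⟨Y, hY⟩ := Finset.exists_le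
    (insert k (((γ₁.walk.support ++ γ₂.walk.support).map fun x : Site 2 => x 1).toFinset))
  have hkY : k ≤ Y := hY k (Finset.mem_insert_self _ _)
  have hs : ∀ x ∈ γ₁.walk.support ++ γ₂.walk.support, x 1 ≤ Y := fun x hx =>
    hY (x 1) (Finset.mem_insert_of_mem (List.mem_toFinset.2 (List.mem_map.2 ⟨x, hx, rfl⟩)))
  have key := wcross_le_of_wind_nonneg hG γ₁.walk γ₂.walk hkY
    (fun x hx => hs x (List.mem_append_left _ hx)) (fun x hx => hs x (List.mem_append_right _ hx))
    (h (probeL m k))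
  omega

/-- `cornerA Ω` is `≼`-up-closed (no side condition). [folklore] -/
theorem isUp_cornerA (Ω : Set ℂ) :
    ∀ γ₁ γ₂, lr γ₁ γ₂ → γ₁ ∈ cornerA Ω → γ₂ ∈ cornerA Ω :=
  fun γ₁ γ₂ h h₁ => le_wcross_of_lr 0 0 1 γ₁ γ₂ h h₁

/-- `cornerB Ω` is `≼`-up-closed (no side condition). [folklore] -/
theorem isUp_cornerB (Ω : Set ℂ) :
    ∀ γ₁ γ₂, lr γ₁ γ₂ → γ₁ ∈ cornerB Ω → γ₂ ∈ cornerB Ω :=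
  fun γ₁ γ₂ h h₁ => le_wcross_of_lr 1 1 1 γ₁ γ₂ h h₁

/-- **Reduction (sorry-free): the four counts on `Ω(sq3)` refute `CountFKG` at the witness datum**
`(δ, c, a, b, a', b', C) = (1, (-1,-1), (0,0), (2,2), (0,-1), (2,3), sq3)`.  Discharged here: `δ = 1 > 0`,
`a' = (0,-1) ∈ C₃`, `b' = (2,3) ∈ C₃`, `a ∼ a'`, `b ∼ b'` (`decide`), up-closedness of the two corner events
(`le_wcross_of_lr`); then `6 · 6 ≤ 12 · 2` is false in `ℝ≥0∞`.  (= the body of `Disproof.notFKGAtOne_of_counts3x3`;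
stated one `notFKGAtOne_iff`-step below the crux so that `NotFKGAtOne_of` is the ONLY theorem of this file
concluding the crux by name.) [folklore] -/
theorem not_countFKG_sq3_of_counts (h : Counts (dom 1 sq3)) :
    ¬ CountFKG 1 (P (-1) (-1)) (P 0 0) (P 2 2) (P 0 (-1)) (P 2 3) sq3 := by
  intro hC
  obtain ⟨cA, cB, cU, cAB⟩ := h
  have key := hC one_pos mem_sq3_support_a' mem_sq3_support_b' (by decide) (by decide)
    (cornerA (dom 1 sq3)) (cornerB (dom 1 sq3)) (isUp_cornerA _) (isUp_cornerB _)
  rw [cA, cB, cU, cAB] at key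
  have e1 : (6 : ℝ≥0∞) * 6 = ((36 : ℕ) : ℝ≥0∞) := by norm_num
  have e2 : (12 : ℝ≥0∞) * 2 = ((24 : ℕ) : ℝ≥0∞) := by norm_num
  rw [e1, e2] at key
  exact absurd (Nat.cast_le.1 key) (by norm_num)

/-! ## §3 Statements of the stubs (the COUNT side) -/

/-- STATEMENT OF STUB 1 (winding numbers of the boundary walk; M): the open square `(-1,3)²` lies in
`Ω(sq3) = {wind(sq3, ·) ≠ 0}` (inside, the index is `1`: `wind_poly_probeL` with `pathCross 0 0 = -1` of the
boundary chain, spread over the convex open square by `wind_sub_eq_of_mem_connectedComponentIn`), and the mesh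
vertices of `Ω(sq3)` are EXACTLY the box `{0,1,2}²` (lattice points of `∂[-1,3]²` are vertices of `sq3`, junk
index `0`: `wind_eq_zero_of_mem_range`; outside the closed square the index is `0`: `wind_poly_eq_zero_far`).
Replay of the landed `LeftRightFKG/Negative/BoxDomain.lean` (`Rint_subset_Ωb`, `meshVertices_Ωb`, the 5 × 4
box of the sibling crux) for the 3 × 3 square; all its generic lemmas are importable. [folklore] -/
def WindBox : Prop :=
  Rint₃ ⊆ dom 1 sq3 ∧ meshVertices (dom 1 sq3) 1 = box₃

/-- STATEMENT OF STUB 2 (the discrete domain of such an `Ω` is the induced box graph; S/M): for ANY `Ω ⊆ ℂ`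
containing the open square `(-1,3)²` whose mesh-`1` vertices are exactly the box `{0,1,2}²`, adjacency in
`discreteDomainGraph Ω 1` is lattice adjacency inside the box.  Ingredients: box neighbours are mesh-adjacent
(the unit segment lies in the convex `Rint₃ ⊆ Ω ⊆ closure Ω`, `meshGraph_adj_iff`); the induced mesh graph on
the 9 box sites is connected, so the largest component is everything
(`Percolation.meshDomain_eq_meshVertices_of_preconnected`); `discreteDomainGraph_adj_iff`.  Replay of the landed
`LeftRightFKG/Negative/BoxMesh.lean` (`meshDomain_Ωb`, `dAdj_iff`). [folklore] -/
def MeshBox : Prop :=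
  ∀ Ω : Set ℂ, Rint₃ ⊆ Ω → meshVertices Ω 1 = box₃ → BoxAdj Ω

/-- STATEMENT OF STUB 3 (certified census; M, hardest): for ANY `Ω` whose discrete domain graph is the box
graph, the chords `(0,0) → (2,2)` number 12, those with `1 ≤ wcross 0 0` number 6, those with `1 ≤ wcross 1 1`
number 6, and 2 have both.  Ingredients: from `BoxAdj Ω` the tree's neighbour lister `nb₃` is complete and sound
for `discreteDomainGraph Ω 1` (proofs of `mem_nb₃` / `nb₃_adj` with `adj₃_iff` replaced by the hypothesis) and
chords have `≤ 8` steps (`length_lt_card_of_adj_mem T₃`); the support map `γ ↦ γ.walk.support` is injective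
(`walk_eq_of_support_eq`) onto `L = (pathsFrom eqSite nb₃ 8 (P 0 0) []).filter (endsAt eqSite (P 2 2))`
(`support_mem_pathsFrom` / `exists_walk_of_mem_pathsFrom` / `endsAt_support`), and `wcross m k γ.walk =
pathCross m k (P 0 0) γ.walk.support.tail` by `rfl`; so `Measure.count S = (L.filter p).length` for support
predicates (`Measure.count_apply` on the `⊤` σ-algebra = `Set.encard`, `L.Nodup` by `decide`), and the four
numbers are `census_decide` below.  (Alternative: transport to the tree's `Ω₃` along `BoxAdj Ω ∧ adj₃_iff` with
`SimpleGraph.Walk.transfer`, supports preserved.) [folklore] -/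
def BoxCensus : Prop :=
  ∀ Ω : Set ℂ, BoxAdj Ω → Counts Ω

/-! ### Sanity: the list-side census, kernel-decided (cheapest falsifier of the line — passed) -/

open Summit.CriticalPhenomena.SAWScalingLimit.Theorems.BoundaryTP2.Negative in
/-- The enumerated corner-to-corner supports of the 3 × 3 box (first-step DFS `pathsFrom` with the tree's
neighbour lister `nb₃`, fuel 8, kept if ending at `(2,2)`). [folklore] -/
def chords₃ : List (List (Site 2)) :=
  (pathsFrom eqSite nb₃ 8 (P 0 0) []).filter (endsAt eqSite (P 2 2))

/-- **Census (kernel `decide`)**: 12 chords; 6 with `1 ≤ pathCross 0 0` (first step North); 6 with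
`1 ≤ pathCross 1 1` (last step from the West); 2 with both; the list is duplicate-free.  These are the four
numbers of `Counts`, read on supports (`wcross m k γ.walk = pathCross m k (P 0 0) γ.walk.support.tail`).
[folklore] -/
theorem census_decide :
    chords₃.length = 12 ∧
    (chords₃.filter fun s => decide (1 ≤ pathCross 0 0 (P 0 0) s.tail)).length = 6 ∧
    (chords₃.filter fun s => decide (1 ≤ pathCross 1 1 (P 0 0) s.tail)).length = 6 ∧
    (chords₃.filter fun s =>
      decide (1 ≤ pathCross 0 0 (P 0 0) s.tail) && decide (1 ≤ pathCross 1 1 (P 0 0) s.tail)).length = 2 ∧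
    chords₃.Nodup := by
  decide

/-- Sanity: `BoxAdj` is exactly the shape of the tree's `adj₃_iff` — the 3 × 3 site domain `Ω₃` satisfies it
(so `BoxCensus` specialises to a statement about the tree's box, and a prover of stub 3 may transport there).
[folklore] -/
theorem boxAdj_Ω₃ : BoxAdj Summit.CriticalPhenomena.SAWScalingLimit.Theorems.BoundaryTP2.Negative.Ω₃ :=
  fun _ _ => Summit.CriticalPhenomena.SAWScalingLimit.Theorems.BoundaryTP2.Negative.adj₃_iff

/-! ## §4 Registered stubs -/

/-- STUB 1 (M): winding numbers of `sq3` — `(-1,3)² ⊆ Ω(sq3)` and `meshVertices (Ω(sq3)) 1 = {0,1,2}²`, see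
`WindBox`. [folklore] -/
theorem stub_windBox : WindBox := by
  sorry

/-- STUB 2 (S/M): mesh edges + largest component — the discrete domain graph of any `Ω ⊇ (-1,3)²` with mesh
vertices `{0,1,2}²` is the induced box graph, see `MeshBox`. [folklore] -/
theorem stub_meshBox : MeshBox := by
  sorry

/-- STUB 3 (M, hardest): the certified census `6 / 6 / 12 / 2` over any `Ω` with the box graph, see
`BoxCensus` (numbers = `census_decide`). [folklore] -/
theorem stub_boxCensus : BoxCensus := by
  sorry

/-! ## Name-keyed aliases of the three statements (hypotheses of the composition)

`Registered.stub_X` is the statement of `stub_X` under the registered stub's short name, so that the native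
skeleton audit (`#h21_check_skeleton`: hypotheses admissible iff registered obligations / declared stubs BY
NAME) accepts `NotFKGAtOne_of : Registered.stub_windBox → … → NotFKGAtOne` (device of
`Cruxes/LeftRightFKG/Lines/corner-localisation.lean`). -/
namespace Registered

/-- Alias of `WindBox` keyed by the registered stub name. [folklore] -/
abbrev stub_windBox : Prop := WindBox
/-- Alias of `MeshBox` keyed by the registered stub name. [folklore] -/
abbrev stub_meshBox : Prop := MeshBox
/-- Alias of `BoxCensus` keyed by the registered stub name. [folklore] -/
abbrev stub_boxCensus : Prop := BoxCensus

end Registered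

/-! ## §5 Composition (kernel-checked, no `sorry`) -/

/-- Stubs 1–3 give the four counts on the witness domain `Ω(sq3)`. [folklore] -/
theorem counts_sq3 (h₁ : WindBox) (h₂ : MeshBox) (h₃ : BoxCensus) : Counts (dom 1 sq3) := by
  obtain ⟨hR, hV⟩ := h₁
  exact h₃ (dom 1 sq3) (h₂ (dom 1 sq3) hR hV)

/-- THE LINE: the three stub statements (keyed by the stubs' names) imply the crux BY NAME — the witness datum
`(1, (-1,-1), (0,0), (2,2), (0,-1), (2,3), sq3)` violates `CountFKG` (`not_countFKG_sq3_of_counts ∘ counts_sq3`),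
which is the crux by `notFKGAtOne_iff`. [folklore] -/
theorem NotFKGAtOne_of (h₁ : Registered.stub_windBox) (h₂ : Registered.stub_meshBox)
    (h₃ : Registered.stub_boxCensus) :
    Summit.CriticalPhenomena.SAWScalingLimit.Theses.SAWLeftRightFKG.NotFKGAtOne :=
  notFKGAtOne_iff.2 ⟨1, P (-1) (-1), P 0 0, P 2 2, P 0 (-1), P 2 3, sq3,
    not_countFKG_sq3_of_counts (counts_sq3 h₁ h₂ h₃)⟩

/-- WIRING CHECK: the three registered stubs feed `NotFKGAtOne_of` as stated (an `example`, so that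
`NotFKGAtOne_of` stays the only theorem concluding the crux). -/
example : Summit.CriticalPhenomena.SAWScalingLimit.Theses.SAWLeftRightFKG.NotFKGAtOne :=
  NotFKGAtOne_of stub_windBox stub_meshBox stub_boxCensus

end Summit.CriticalPhenomena.SAWScalingLimit.Cruxes.NotFKGAtOne.ThreeByThreeCornerWitness

end
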